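import Literature.IUT.HodgeTheaters.GlobalFrobenioidsArithmeticCor411GF
import HarnessLib

/-!
# [IUTchI] Cor 5.3 (i) at the GENUINE `ℱ^⊛(†𝒟^⊚)`: the [FrdI] half of the law `hrat⊛` is a THEOREM — every
# self-equivalence over the identity of `†𝒟^⊛` moves zero divisors through a NATURAL AUTOMORPHISM `θ_Ψ` of `Φ^⊛`
# over the identity and a UNIQUE base identification `η'` ([FrdI] Cor 4.11 (ii)/(iv), hypothesis-free)

S. Mochizuki, *Inter-universal Teichmüller theory I*, kurims manuscript (May 2020), §5 Corollary 5.3 (i) p. 144 l. 2–11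
(«the natural map `Isom(¹ℱ^⊛, ²ℱ^⊛) → Isom(Base(¹ℱ^⊛), Base(²ℱ^⊛))` … is bijective»), proof p. 144 l. 24–33 («follows
immediately from the category-theoreticity of the "isomorphism `𝕄^⊛(†𝒟^⊚) ⥲ †𝕄^⊛`" of Example 5.1, (v)»)
([IUTchI] Cor 5.3 (i) p.144) [claim: Mochizuki2012, status: disputed] (D-0012 claim key; nothing of the series is asserted;
no side taken on [IUTchIII] Cor. 3.12).  The mathematics used is S. Mochizuki, *The geometry of Frobenioids I*, Kyushu J.
Math. **62** (2008), Cor. 4.11 (ii)/(iv) pp. 91–92 [cite: MochizukiFrdI2008, Cor. 4.11 p.91] — AS PROVED in the tree at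
this carrier by abc-iut-w4-d109 (`GlobalDivisorData.exists_cor411iv_data_arith`, hypothesis-free).

PROOF-ONLY (theorems only; cell abc-iut, seat abc-iut-L5-t11 gen 16, row R81 «COR53I-HRAT@ARITH», abc-iut-L5-lead
RULINGS #148 (2); file 1 of 2).  CONTEXT.  abc-iut-L5-t4 gen 7's ★ p517769 `Cor53.arith_rigidOverBase_of_divRatioRigid`
gives `RigidOverBase (arith F).modelBase` (the `hker⊛` binder of [IUTchI] Cor 5.3 (i) at `ℱ^⊛(†𝒟^⊚)`) from ONE law
`hrat⊛ = ∃ η, (hdiv) ∧ (hratio)`: every self-equivalence `Ψ` over the identity of `†𝒟^⊛` admits an identification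
`η : Ψ ⋙ Base ≅ Base` through which it induces the identity on the divisor monoid (hdiv) and preserves the birational
units of parallel linear arrows (hratio).  THIS FILE proves what the LANDED [FrdI] theorems give toward (hdiv):

* `arith_overBase_iso_unique` — the identification `η' : Ψ ⋙ Base ≅ Base` of a self-equivalence over the identity is
  UNIQUE ([FrdI] Cor 4.11 (ii) rigid composites: `IsRigidFunctor (Ψ ⋙ Base)`, `G_F` slim);
* `PreFrobenioidData.DivisorMonoidIsoOverBase.exists_transport_along_iso` (generic bookkeeping): a divisor-monoid
  isomorphism over `ΨBase` and an isomorphism `ε : 𝟭 ≅ ΨBase` yield a divisor-monoid isomorphism over `𝟭` (pull back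
  along `ε`);
* **`arith_exists_divAut_of_overBase`** — for every `Ψ` over the identity there are a NATURAL AUTOMORPHISM
  `θ : DivisorMonoidIsoOverBase S S (𝟭 _)` of `Φ^⊛` over the identity (`S = ModelFrobenioid.data …`) and an identification
  `η' : Ψ ⋙ Base ≅ Base` with `Div(Ψ φ) = η'_A^* θ_{A.base}(Div φ)` for EVERY arrow `φ : A → B` — from the Cor 4.11 (iv)
  data `(ΨBase, Ψ^Φ, η)` and the `1`-uniqueness of the base square (`ΨBase ≅ 𝟭`).

CONSEQUENCE for the census of `hrat⊛` (file 2, `Cor53iArithHratOfMonoidRigidity`): (hdiv) ⟺ «`θ_Ψ = 1`»; this is NOT an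
[FrdI] statement and is FALSE for a bare natural automorphism of `Φ^⊛` (archimedean rescaling), but follows from (hratio)
— which makes `θ_Ψ` fix principal divisors — and the CLASSICAL rigidity of the arithmetic divisor monoid.  HONEST TAGS:
nothing of [IUTchI] is asserted; no law is introduced here (every hypothesis of every theorem below is a structural
datum); typed ≠ proved for Cor 5.3 (i) itself; nothing here asserts abc proved or refuted.
-/

noncomputable section

-- `(PreFrobenioidData.ofFunctor Φ F).base` / `.Mon` / `.pull` and `ModelFrobenioid.data` unfold only at default transparency
-- (as in abc-iut-w4-d109's `GlobalFrobenioidsArithmeticCor411GF`).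
set_option backward.isDefEq.respectTransparency false

namespace Literature.AlgebraicGeometry.Frobenioids

open CategoryTheory

namespace PreFrobenioidData

universe w v u v' u'

variable {C : Type u} [Category.{v} C] {D : Type u'} [Category.{v'} D] (S : PreFrobenioidData.{w} C D)

/-- **Transport of a divisor-monoid isomorphism over `ΨBase` along `ε : 𝟭 ≅ ΨBase`** ([FrdI] Cor 4.11 (iii)/(iv)
bookkeeping): `x ↦ ε_X^* (Ψ^Φ_X x)` is a divisor-monoid isomorphism over the IDENTITY (a natural automorphism of `Φ`),
naturality following from that of `Ψ^Φ` and of `ε`. [cite: MochizukiFrdI2008, Cor. 4.11 (iii) p.92] -/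
theorem DivisorMonoidIsoOverBase.exists_transport_along_iso {ΨBase : D ⥤ D}
    (E : S.DivisorMonoidIsoOverBase S ΨBase) (ε : 𝟭 D ≅ ΨBase) :
    ∃ θ : S.DivisorMonoidIsoOverBase S (𝟭 D), ∀ (X : D) (x : S.Mon X), θ.iso X x = S.pull (ε.hom.app X) (E.iso X x) := by
  have hinv₁ : ∀ (X : D) (y : S.Mon (ΨBase.obj X)), S.pull (ε.inv.app X) (S.pull (ε.hom.app X) y) = y := by
    intro X y
    rw [← S.pull_comp, ε.inv_hom_id_app]
    exact S.pull_id _ y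
  have hinv₂ : ∀ (X : D) (x : S.Mon ((𝟭 D).obj X)), S.pull (ε.hom.app X) (S.pull (ε.inv.app X) x) = x := by
    intro X x
    rw [← S.pull_comp, ε.hom_inv_id_app]
    exact S.pull_id _ x
  refine ⟨{ iso := fun X => (E.iso X).trans
              (MonoidHom.toMulEquiv (S.pull (ε.hom.app X)) (S.pull (ε.inv.app X))
                (MonoidHom.ext (hinv₁ X)) (MonoidHom.ext (hinv₂ X)))
            natural := ?_ }, fun X x => rfl⟩
  intro X Y f x
  show S.pull (ε.hom.app Y) (E.iso Y (S.pull f x)) = S.pull ((𝟭 D).map f) (S.pull (ε.hom.app X) (E.iso X x))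
  rw [E.natural, ← S.pull_comp, ← S.pull_comp, ← ε.hom.naturality f]

end PreFrobenioidData

end Literature.AlgebraicGeometry.Frobenioids

namespace Literature.IUT.HodgeTheaters

open CategoryTheory Opposite Literature.AlgebraicGeometry.Frobenioids

namespace GlobalDivisorData

section Arith

variable (F : Type) [Field F] [NumberField F]

/-- **The base identification of a self-equivalence of `ℱ^⊛(†𝒟^⊚)` over the identity of `†𝒟^⊛` is UNIQUE**: the
composite `Ψ ⋙ Base` is rigid ([FrdI] Cor 4.11 (ii) at the carrier, `G_F` slim — abc-iut-w4-d109
`exists_oneUniqueSquare_base_arith`), so any two `η₁ η₂ : Ψ ⋙ Base ≅ Base` coincide. ([IUTchI] Ex 5.1 (iii) p.125)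
[cite: MochizukiFrdI2008, Cor. 4.11 (ii) p.91] [claim: Mochizuki2012, status: disputed] -/
theorem arith_overBase_iso_unique (Ψ : (arith F).ModelGlobalFrobenioid ≌ (arith F).ModelGlobalFrobenioid)
    (η₁ η₂ : Ψ.functor ⋙ (arith F).modelBase ≅ (arith F).modelBase) : η₁ = η₂ := by
  obtain ⟨-, -, hrig, -⟩ := exists_oneUniqueSquare_base_arith F F Ψ
  have h := hrig (η₁ ≪≫ η₂.symm)
  calc η₁ = (η₁ ≪≫ η₂.symm) ≪≫ η₂ := by rw [Iso.trans_assoc, Iso.symm_self_id, Iso.trans_refl]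
    _ = η₂ := by rw [h, Iso.refl_trans]

/-- **[FrdI] Cor 4.11 (iv) for a self-equivalence OVER THE IDENTITY of `†𝒟^⊛`, hypothesis-free: zero divisors move
through a NATURAL AUTOMORPHISM `θ_Ψ` of `Φ^⊛` over `𝟭` and a base identification `η'`** — for every
`Ψ : ℱ^⊛(†𝒟^⊚) ⥲ ℱ^⊛(†𝒟^⊚)` with `Ψ ⋙ Base ≅ Base` there are `θ : DivisorMonoidIsoOverBase S S (𝟭 _)` and
`η' : Ψ ⋙ Base ≅ Base` with `Div(Ψ φ) = η'_A^* θ_{Base A}(Div φ)` for all `φ : A → B`.  PROOF: abc-iut-w4-d109's Cor 4.11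
(iv) data `(ΨBase, Ψ^Φ, η)` (`exists_cor411iv_data_arith`); the `1`-uniqueness of the base square gives `ε : 𝟭 ≅ ΨBase`;
`θ := ε^* ∘ Ψ^Φ` (`exists_transport_along_iso`), `η' := η · Base(ε⁻¹)`.  So the (hdiv) clause of `hrat⊛` holds for `Ψ`
IFF `θ_Ψ` is the identity — the [FrdI] content of (hdiv) is exhausted here. ([IUTchI] Cor 5.3 (i) p.144)
[cite: MochizukiFrdI2008, Cor. 4.11 (iv) p.92] [claim: Mochizuki2012, status: disputed] -/
theorem arith_exists_divAut_of_overBase (Ψ : (arith F).ModelGlobalFrobenioid ≌ (arith F).ModelGlobalFrobenioid)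
    (h : Nonempty (Ψ.functor ⋙ (arith F).modelBase ≅ (arith F).modelBase)) :
    ∃ (θ : (ModelFrobenioid.data (arith F).Φ (arith F).B (arith F).div).DivisorMonoidIsoOverBase
        (ModelFrobenioid.data (arith F).Φ (arith F).B (arith F).div) (𝟭 (BaseCat (absGalGrp F))))
      (η' : Ψ.functor ⋙ (arith F).modelBase ≅ (arith F).modelBase),
      ∀ ⦃A B : (arith F).ModelGlobalFrobenioid⦄ (φ : A ⟶ B),
        ModelFrobenioid.div (Ψ.functor.map φ) =
          Literature.AlgebraicGeometry.Frobenioids.pull (arith F).Φ (η'.hom.app A)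
            (θ.iso A.base (ModelFrobenioid.div φ)) := by
  obtain ⟨ΨBase, E', η, hsq, -, hdivE, -, -, -⟩ := exists_cor411iv_data_arith F F Ψ
  obtain ⟨h⟩ := h
  -- the `1`-uniqueness of the base square: `ΨBase ≅ 𝟭`
  obtain ⟨ε⟩ := hsq.2.2 (𝟭 _) ⟨h ≪≫ (Functor.rightUnitor _).symm⟩
  obtain ⟨θ, hθ⟩ := PreFrobenioidData.DivisorMonoidIsoOverBase.exists_transport_along_iso _ E' ε
  refine ⟨θ, η ≪≫ Functor.isoWhiskerLeft (arith F).modelBase ε.symm ≪≫ (arith F).modelBase.rightUnitor,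
    fun A B φ => ?_⟩
  rw [hdivE φ, hθ]
  simp only [Iso.trans_hom, NatTrans.comp_app, Functor.isoWhiskerLeft_hom, Functor.whiskerLeft_app, Iso.symm_hom,
    Functor.rightUnitor_hom_app]
  rw [Literature.AlgebraicGeometry.Frobenioids.pull_comp]
  congr 1
  change _ = Literature.AlgebraicGeometry.Frobenioids.pull (arith F).Φ (ε.inv.app A.base)
    (Literature.AlgebraicGeometry.Frobenioids.pull (arith F).Φ (ε.hom.app A.base) (E'.iso A.base (ModelFrobenioid.div φ)))
  rw [← Literature.AlgebraicGeometry.Frobenioids.pull_comp, ε.inv_hom_id_app,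
    Literature.AlgebraicGeometry.Frobenioids.pull_id]

end Arith

end GlobalDivisorData

end Literature.IUT.HodgeTheaters

end
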